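import Summits.ResolutionOfSingularities.ResolutionOfSingularities.Theorems.MarkedTransferCampaignW46TameSurfaceOrderReductionComplete
import Literature.AlgebraicGeometry.Resolution.KollarSurfaceOrderReductionTameBoundary
import HarnessLib

/-!
# [OURS · L1 W4.6, rung (iv) «large characteristic» ∩ rung (i) «surfaces»] In the regime `charGT n (fun _ b ↦ b) ∩ dimLE 2`
# the characteristic-zero order reduction of every state of maximal order TOGETHER WITH ANY simple normal crossing boundary
# is ONE smooth blow-up sequence on `Z` with empty final `Sing` (cell res-hironaka, LADDER-RESOLUTION rung L, D-0089;
# slot W4.6, seat res-L1-s46-pv-7; host route MarkedTransfer, `--supports stmt-ResolutionOfSingularities-16155 --as helper`)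

HONEST FRAMING. Nothing here is a statement of H. Hironaka's manuscript (2017-03-23, [Hironaka2017]) and nothing here
asserts that any statement of it holds. OURS corollary, over the shared typed-procedure module
`MarkedTransferCampaignW46TypedProcedure` (res-L1-type-o1: `CampaignW46.Regime.charGT`, `Regime.dimLE`, `Regime.inter`;
the manuscript enters only through the typed CANDIDATE carriers `AmbientDatum`, `IdealExponent`, `IdealExponent.sing`,
used as definitions), of this seat's Literature file `KollarSurfaceOrderReductionTameBoundary.lean`
(`Kollar2007.exists_isResolutionOf_boundary_of_topologicalKrullDim_le_two`: Kollár's Thm. 3.69 — order reduction for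
MARKED ideals `(X, I, m, E)` WITH a simple normal crossing boundary `E` — in dimension two for `p > max-ord`,
kernel-proved along Kollár's own steps: Lemma 3.102 for every member of `E`, 3.111 Step 1 for the curve part, 3.104
Step 2.2 with 3.105 at the remaining points, the maximal-contact charts of Thm. 3.80 carried along the sequence in
simple normal crossing position with the new exceptional divisors). No premise of the manuscript, no FACT-LIST premise.
AI review is weaker than expert review. No `sorry`, no new definition; axioms standard.

## What this file pins — the boundary version of gen 6's surface theorem (the input of the dimension-three induction)

* **`exists_isResolutionOf_boundary_of_charGT_dimLE`** — for a state `(A, E)`, `E = (J, b)`, over a PERFECT field `K`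
  of characteristic `p`, in `Regime.inter (Regime.charGT n (fun _ b ↦ b)) (Regime.dimLE 2)`, with `1 ≤ b`, `J` of
  maximal order `b`, and ANY simple normal crossing boundary `B` on `Z` (e.g. the exceptional configuration of an
  earlier run): there is `s : CentreSeq Z` RESOLVING `(Z, J, B, b)` (BGMW Def. 3.1.3: regular centres in the successive
  `Sing`, simple normal crossings with the successive TOTAL boundaries, EMPTY final `Sing`);
* `exists_isResolutionOf_boundary_of_le_dimLE` — the same in every regime `charGT n f ∩ dimLE 2` with `(fun _ b ↦ b) ≤ f`;
* `sing_final_eq_empty_boundary_of_charGT_dimLE` — reading of the conclusion.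

What is NOT here: `dim Z ≥ 3` (the second level is a surface WITH boundary and marking `b!` — now covered by this
file — but its orders are unbounded in `b`, gen 5); the identification of the produced `CentreSeq` with a typed `Run`.

## References (context; nothing is cited as a premise)

* J. Kollár, *Lectures on Resolution of Singularities* (2007), Thm. 3.69, Lemma 3.102, 3.103–3.105, 3.111 — through
  this seat's Literature files. [cite: Kollar2007, Thm. 3.69]
* E. Bierstone, D. Grigoriev, P. Milman, J. Włodarczyk (2011), Def. 3.1.3, Thm. 8.0.4.
  [cite: BierstoneGrigorievMilmanWlodarczyk2011, Thm. 8.0.4]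
-/

noncomputable section

set_option linter.dupNamespace false -- mandated namespace of this single-conjunct summit

open CategoryTheory AlgebraicGeometry TopologicalSpace IsLocalRing

namespace Summit.ResolutionOfSingularities.ResolutionOfSingularities.Theorems
namespace CampaignW46
namespace TameSurfaceOrderReduction

open Literature.AlgebraicGeometry.Resolution
open Literature.AlgebraicGeometry.Hironaka2017.S02Preliminaries

universe u

variable {n : ℕ} {p : ℕ} [Fact p.Prime] {K : Type u} [Field K] [CharP K p]

/-- [OURS · L1 W4.6 (iv) ∩ (i); NOT a statement of the manuscript] **In the regime `charGT n (fun _ b ↦ b) ∩ dimLE 2`,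
the characteristic-zero order reduction of every state of maximal order, with ANY simple normal crossing boundary,
is ONE smooth blow-up sequence on `Z`.** For a state `(A, E)` over a perfect field `K` of characteristic `p` with
`p > b`, `dim Z ≤ 2`, `1 ≤ b`, `max-ord J ≤ b`, and `B` a simple normal crossing boundary on `Z`, there is a blow-up
sequence on `Z` resolving the marked ideal `(Z, J, B, b)`: Kollár's Thm. 3.69 in dimension two for `p > max-ord`
(`Kollar2007.exists_isResolutionOf_boundary_of_topologicalKrullDim_le_two`; `Z` is Noetherian, being quasi-compact
and smooth over `K`). [cite: Kollar2007, Thm. 3.69] [cite: BierstoneGrigorievMilmanWlodarczyk2011, Def. 3.1.3, Thm. 8.0.4] -/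
theorem exists_isResolutionOf_boundary_of_charGT_dimLE [PerfectField K] (A : AmbientDatum p K)
    (E : IdealExponent A.Z)
    (hE : Regime.inter (Regime.charGT (p := p) (K := K) n (fun _ b => b)) (Regime.dimLE 2) A E) (hb : 1 ≤ E.b)
    (hmax : ∀ ξ : A.Z, idealOrder E.J ξ ≤ E.b) {B : List A.Z.IdealSheafData} (hB : HasSNC B) :
    ∃ s : CentreSeq A.Z, s.IsResolutionOf ⟨E.J, B, E.b⟩ := by
  letI : A.Z.Over (Spec (.of K)) := ⟨A.hom⟩
  haveI : Smooth (A.Z ↘ Spec (.of K)) := A.smooth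
  haveI : QuasiCompact A.hom := A.quasiCompact
  haveI : IsLocallyNoetherian A.Z := isLocallyNoetherian_of_locallyOfFiniteType_over K A.Z
  haveI : CompactSpace A.Z := QuasiCompact.compactSpace_of_compactSpace A.hom
  haveI : IsNoetherian A.Z := {}
  have hbp : E.b < p := hE.1
  have hdim : topologicalKrullDim A.Z ≤ 2 := hE.2
  exact Kollar2007.exists_isResolutionOf_boundary_of_topologicalKrullDim_le_two K A.Z p hdim E.J hB hb
    (Or.inr hbp) hmax

/-- [OURS · L1 W4.6 (iv) ∩ (i)] The same in every regime `charGT n f ∩ dimLE 2` whose threshold dominates the order,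
`(fun _ b ↦ b) ≤ f` (e.g. V5's `b!`). [cite: Kollar2007, Thm. 3.69] -/
theorem exists_isResolutionOf_boundary_of_le_dimLE [PerfectField K] {f : ℕ → ℕ → ℕ} (hf : (fun _ b : ℕ => b) ≤ f)
    (A : AmbientDatum p K) (E : IdealExponent A.Z)
    (hE : Regime.inter (Regime.charGT (p := p) (K := K) n f) (Regime.dimLE 2) A E) (hb : 1 ≤ E.b)
    (hmax : ∀ ξ : A.Z, idealOrder E.J ξ ≤ E.b) {B : List A.Z.IdealSheafData} (hB : HasSNC B) :
    ∃ s : CentreSeq A.Z, s.IsResolutionOf ⟨E.J, B, E.b⟩ :=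
  exists_isResolutionOf_boundary_of_charGT_dimLE A E ⟨Regime.charGT_of_le (fun b => hf n b) A E hE.1, hE.2⟩
    hb hmax hB

/-- [OURS · L1 W4.6 (iv) ∩ (i)] **Reading of the conclusion**: for the sequence produced above every centre is
regular, lies in the current order-`≥ b` locus and has simple normal crossings with the current TOTAL boundary (the
birational transforms of the members of `B` followed by the exceptional divisors created so far), and the
order-`≥ b` locus (`IdealExponent.sing`) of the final controlled transform is EMPTY.
[cite: BierstoneGrigorievMilmanWlodarczyk2011, Def. 3.1.3] -/
theorem sing_final_eq_empty_boundary_of_charGT_dimLE [PerfectField K] (A : AmbientDatum p K)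
    (E : IdealExponent A.Z)
    (hE : Regime.inter (Regime.charGT (p := p) (K := K) n (fun _ b => b)) (Regime.dimLE 2) A E) (hb : 1 ≤ E.b)
    (hmax : ∀ ξ : A.Z, idealOrder E.J ξ ≤ E.b) {B : List A.Z.IdealSheafData} (hB : HasSNC B) :
    ∃ s : CentreSeq A.Z, s.IsAdmissibleFor ⟨E.J, B, E.b⟩ ∧
      (IdealExponent.sing ⟨(s.transformMarked ⟨E.J, B, E.b⟩).ideal, (s.transformMarked ⟨E.J, B, E.b⟩).mult⟩ :
        Set s.top) = ∅ := by
  obtain ⟨s, hs⟩ := exists_isResolutionOf_boundary_of_charGT_dimLE A E hE hb hmax hB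
  exact ⟨s, hs.1, hs.2⟩

end TameSurfaceOrderReduction
end CampaignW46
end Summit.ResolutionOfSingularities.ResolutionOfSingularities.Theorems

end
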